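import Summits.QuantumFields.YangMills.Theorems.F4SubCurvatureDoorShortRootRigidityTorusFischer
import Mathlib
import HarnessLib

/-!
# TorusReduction, part (TR2'): the three-dimensional theorem behind `NoBadModes`

Crux ⟨stmt-QuantumFields-23035⟩ `F4SubCurvatureDoor.ShortRootRigidity`, stub `:146 stub_oddModeRigidity`, piece `TorusReduction`
(`Cruxes/ShortRootRigidity/Lines/odd_mode_split.lean`).

THE 3D THEOREM (`slice_eq_zero`).  Let `h₀ ∈ ℝ[x₁,x₂,x₃]` be homogeneous of EVEN degree `2K ≥ 2` and `O_h`-invariant (`OhInvariant`), let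
`σ = Rf` be the reflection in the plane `(1,1,1)^⊥`, `a := h₀ + h₀∘σ`, `s = Σxᵢ`, `D = Σ∂ᵢ`, and suppose the PDE `s·Δa + D a = 0` (this is what
the support condition `EvenPartSliceInvariant` of a `W(B₄)`-invariant harmonic polynomial on `ℝ⁴` says about its `x₀ = 0` slice).  Then
`h₀ = 0`, GIVEN (i) trigonal injectivity in the E-free rational form `TrigonalInjectivityQ s` for all `s ≥ 1` (tree: w3 g38) and (ii) the
planar lemma `TransverseVanishing`: a harmonic homogeneous polynomial of degree `n ≥ 1`, `3 ∤ n`, killed by `D` and `S₃`-symmetric is `0`.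

PROOF.  Harmonic Fischer expansion `a = Σⱼ ρʲ ψⱼ` (`ψⱼ` harmonic homogeneous of degree `2K − 2j`; existence from the Literature normal form,
uniqueness = `eq_zero_of_sum_rho_pow_mul_eq_zero` of the ladder file), with `ψⱼ = ψ'ⱼ + ψ'ⱼ∘σ` for the components `ψ'ⱼ` of `h₀`, which inherit
`O_h`-invariance (uniqueness).  By the ladder identity the PDE is `Σⱼ ρʲ Qⱼ = 0` with harmonic `Qⱼ = c₁(j+1)·η'(ψⱼ₊₁) + κⱼ·Dψⱼ`, `κⱼ > 0`,
so every `Qⱼ = 0`; hence `ψⱼ₊₁ = 0 ⇒ Dψⱼ = 0`.  Upward induction in the degree: `ψ'` of degree `2` vanishes (`Harm₂^{O_h} = 0`); a `D`-killed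
`ψⱼ` of degree `n` vanishes by `TransverseVanishing` if `3 ∤ n`, and if `n = 6s` then `ψ'ⱼ∘Pm = ½ψⱼ` is harmonic so `ψ'ⱼ = 0` by
`TrigonalInjectivityQ s`; finally the degree-`0` rung gives `sψ_K = 0`.  So `a = 0`, i.e. `h₀` is `σ`-odd, and an `O_h`-invariant `σ`-odd
polynomial is odd under two diagonal reflections, hence `0` (✓`eq_zero_of_odd_under_two_diagonal_reflections`).

Mathlib + tree only; no `sorry`; no new definitions.  HONEST LABEL: the algebraic core of ONE piece (`TorusReduction`) of the OPEN stub `:146`;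
`AnalyticHalf`, `:146`, ⟨23035⟩, ⟨23125⟩, R2d and the Yang–Mills mass gap remain OPEN; no summit is proved by a line.
LEAD seat `ym-line-sfw-p2` g76 (cell ym-idea-1, free hands).
-/

noncomputable section

open MvPolynomial
open scoped BigOperators

namespace Summit.QuantumFields.YangMills.Theorems.F4SubCurvatureDoorTorus

open Literature.Analysis.Calculus.MvPoly (lap rho lap_add lap_smul lap_zero lap_rho_mul isHomogeneous_lap isHomogeneous_rho
  lap_eq_zero_of_isHomogeneous_le_one toFun hasFDerivAt_toFun derivCLM_apply)
open Literature.Algebra.Polynomial (linSubst eval_bind₁_linSubst pderiv_bind₁_linSubst laplacian_bind₁_linSubst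
  isHomogeneous_bind₁_linSubst pderiv_pderiv_comm)
open Summit.QuantumFields.YangMills.Theorems.F4SubCurvatureDoorTrigonalLine (P3 Pm Rf J3 flipMat OhInvariant TrigonalInjectivityQ
  Rf_mulVec Pm_mulVec Rf_mulVec_eq_σ₁ σ₂_eq_conj)
open Summit.QuantumFields.YangMills.Theorems.F4SubCurvatureDoorTwoReflections (σ₁ σ₂ eq_zero_of_odd_under_two_diagonal_reflections)

/-! ## The main induction -/

/-- **The symmetrised slice vanishes.**  `h₀` homogeneous of degree `2K ≥ 2`, `O_h`-invariant, with `a = h₀ + h₀∘σ` satisfying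
`s·Δa + Da = 0`; given trigonal injectivity (E-free form) at every level and the planar vanishing lemma, `a = 0`. -/
theorem sym_slice_eq_zero (K : ℕ) (hK : 1 ≤ K) (h₀ : P3) (hh : h₀.IsHomogeneous (2 * K)) (hO : OhInvariant h₀)
    (hPDE : (∑ i, X i) * lap (h₀ + bind₁ (linSubst Rf) h₀) + ∑ i, pderiv i (h₀ + bind₁ (linSubst Rf) h₀) = 0)
    (hTI : ∀ s : ℕ, 1 ≤ s → TrigonalInjectivityQ s)
    (h2D : ∀ (n : ℕ) (Y : P3), 1 ≤ n → ¬ 3 ∣ n → Y.IsHomogeneous n → lap Y = 0 → ∑ i, pderiv i Y = 0 →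
      (∀ σ : Equiv.Perm (Fin 3), rename σ Y = Y) → Y = 0) :
    h₀ + bind₁ (linSubst Rf) h₀ = 0 := by
  -- Fischer expansion of `h₀` and the `O_h`-invariance of its components
  obtain ⟨ψ', hhom', hharm', hexp'⟩ := exists_fischer (2 * K) h₀ hh
  rw [show 2 * K / 2 = K by omega] at hexp'
  have hOψ' : ∀ j ≤ K, OhInvariant (ψ' j) := by
    intro j hj
    refine ⟨fun σ => ?_, fun i => ?_⟩
    · exact fischer_component_fixed (rename σ) (rename_rho σ) (lap_rename σ) (fun p n hp => hp.rename_isHomogeneous)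
        ψ' _ hhom' hharm' K (by rw [← hexp']; exact hO.1 σ) j hj
    · exact fischer_component_fixed (bind₁ (linSubst (flipMat i))) (bind₁_flip_rho i)
        (fun p => laplacian_bind₁_linSubst _ (flipMat_mul_transpose i) p) (fun p n hp => isHomogeneous_bind₁_linSubst _ hp)
        ψ' _ hhom' hharm' K (by rw [← hexp']; exact hO.2 i) j hj
  -- the symmetrised components
  set g : P3 →ₐ[ℝ] P3 := bind₁ (linSubst Rf) with hg
  have hgΔ : ∀ p : P3, lap (g p) = g (lap p) := fun p => laplacian_bind₁_linSubst _ Rf_mul_transpose p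
  set ψ : ℕ → P3 := fun j => ψ' j + g (ψ' j) with hψ
  have hhomψ : ∀ j, (ψ j).IsHomogeneous (2 * K - 2 * j) := fun j =>
    (hhom' j).add (isHomogeneous_bind₁_linSubst _ (hhom' j))
  have hharmψ : ∀ j, lap (ψ j) = 0 := fun j => by
    show lap (ψ' j + g (ψ' j)) = 0
    rw [lap_add, hgΔ, hharm', map_zero, add_zero]
  have hexpψ : h₀ + g h₀ = ∑ j ∈ Finset.range (K + 1), rho ^ j * ψ j := by
    have h1 : g h₀ = ∑ j ∈ Finset.range (K + 1), rho ^ j * g (ψ' j) := by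
      rw [hexp', map_sum]
      refine Finset.sum_congr rfl fun j _ => ?_
      rw [map_mul, map_pow, hg, bind₁_Rf_rho]
    rw [h1]
    conv_lhs => rw [hexp']
    rw [← Finset.sum_add_distrib]
    refine Finset.sum_congr rfl fun j _ => ?_
    simp only [hψ]
    ring
  have hpermψ : ∀ j ≤ K, ∀ σ : Equiv.Perm (Fin 3), rename σ (ψ j) = ψ j := by
    intro j hj σ
    show rename σ (ψ' j + g (ψ' j)) = ψ' j + g (ψ' j)
    rw [map_add, hg, rename_bind₁_Rf, (hOψ' j hj).1 σ]
  -- top component: degree 0, hence `D`-killed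
  have hDψK : ∑ i, pderiv i (ψ K) = 0 :=
    sumPderiv_eq_zero_of_isHomogeneous_zero (by simpa using hhomψ K)
  -- the ladder: `Σ_{i<K} ρⁱ Qᵢ = 0`
  set c₁ : ℕ → ℝ := fun j => 2 * (j : ℝ) * (2 * j + 2 * (2 * K - 2 * j : ℕ) + 2) with hc₁
  set κ : ℕ → ℝ := fun j => 2 * (j : ℝ) * (2 * j + 2 * (2 * K - 2 * j : ℕ) + 2) * (2 * ((2 * K - 2 * j : ℕ) : ℝ) + 1)⁻¹ + 1 with hκ
  set η' : ℕ → P3 := fun j => (∑ i, X i) * ψ j - (2 * ((2 * K - 2 * j : ℕ) : ℝ) + 1)⁻¹ • (rho * ∑ i, pderiv i (ψ j)) with hη'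
  set Q : ℕ → P3 := fun j => c₁ (j + 1) • η' (j + 1) + κ j • ∑ i, pderiv i (ψ j) with hQ
  have hQsum : ∑ j ∈ Finset.range (K - 1 + 1), rho ^ j * Q j = 0 := by
    rw [show K - 1 + 1 = K by omega]
    have hlad : ∀ j, (∑ i, X i) * lap (rho ^ j * ψ j) + ∑ i, pderiv i (rho ^ j * ψ j) =
        c₁ j • (rho ^ (j - 1) * η' j) + κ j • (rho ^ j * ∑ i, pderiv i (ψ j)) := fun j =>
      ladder_identity (hhomψ j) (hharmψ j) j
    have h0 : (∑ i, X i) * lap (h₀ + g h₀) + ∑ i, pderiv i (h₀ + g h₀) =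
        ∑ j ∈ Finset.range (K + 1), (c₁ j • (rho ^ (j - 1) * η' j) + κ j • (rho ^ j * ∑ i, pderiv i (ψ j))) := by
      rw [hexpψ, lap_sum, Finset.mul_sum]
      simp_rw [map_sum]
      rw [Finset.sum_comm, ← Finset.sum_add_distrib]
      exact Finset.sum_congr rfl fun j _ => hlad j
    rw [hPDE, Finset.sum_add_distrib, Finset.sum_range_succ' (fun j => c₁ j • (rho ^ (j - 1) * η' j)),
      Finset.sum_range_succ (fun j => κ j • (rho ^ j * ∑ i, pderiv i (ψ j))), hDψK, mul_zero, smul_zero, add_zero] at h0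
    have hc0 : c₁ 0 = 0 := by simp [hc₁]
    rw [hc0, zero_smul, add_zero, ← Finset.sum_add_distrib] at h0
    rw [h0]
    refine Finset.sum_congr rfl fun j _ => ?_
    simp only [hQ, Nat.add_sub_cancel, mul_add, mul_smul_comm]
  -- every `Qⱼ` vanishes (uniqueness of the Fischer expansion in degree `2K − 1`)
  have hQhom : ∀ j, (Q j).IsHomogeneous (2 * K - 2 * (j + 1) + 1) := by
    intro j
    have hη : (c₁ (j + 1) • η' (j + 1)).IsHomogeneous (2 * K - 2 * (j + 1) + 1) := by
      rw [smul_eq_C_mul]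
      simpa using (isHomogeneous_C _ (c₁ (j + 1))).mul (isHomogeneous_eta' (hhomψ (j + 1)))
    refine hη.add ?_
    by_cases hj : j < K
    · have h := IsHomogeneous.sum _ _ _ fun i (_ : i ∈ Finset.univ) => (hhomψ j).pderiv (i := i)
      rw [show 2 * K - 2 * j - 1 = 2 * K - 2 * (j + 1) + 1 by omega] at h
      rw [smul_eq_C_mul]
      simpa using (isHomogeneous_C _ (κ j)).mul h
    · have hD : ∑ i, pderiv i (ψ j) = 0 :=
        sumPderiv_eq_zero_of_isHomogeneous_zero (by simpa [show 2 * K - 2 * j = 0 by omega] using hhomψ j)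
      rw [hD, smul_zero]
      exact isHomogeneous_zero _ _ _
  have hQharm : ∀ j, lap (Q j) = 0 := by
    intro j
    simp only [hQ]
    rw [lap_add, lap_smul, lap_smul, lap_eta'_eq_zero (hhomψ (j + 1)) (hharmψ (j + 1)), lap_sumPderiv, hharmψ j]
    simp
  have hQzero : ∀ j ≤ K - 1, Q j = 0 :=
    eq_zero_of_sum_rho_pow_mul_eq_zero Q _ hQhom hQharm (K - 1) hQsum
  -- the step: `ψ_{i+1} = 0 ⇒ Dψᵢ = 0`
  have hstep : ∀ i ≤ K - 1, ψ (i + 1) = 0 → ∑ k, pderiv k (ψ i) = 0 := by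
    intro i hi hzero
    have h := hQzero i hi
    have hη : η' (i + 1) = 0 := by simp only [hη', hzero, mul_zero, map_zero, Finset.sum_const_zero, smul_zero, sub_zero]
    simp only [hQ, hη, smul_zero, zero_add] at h
    exact (smul_eq_zero.mp h).resolve_left (kappa_pos _ _).ne'
  -- the vanishing: a `D`-killed `ψᵢ` of degree `n ≥ 2` vanishes
  have hvanish : ∀ i ≤ K - 1, ∑ k, pderiv k (ψ i) = 0 → ψ i = 0 := by
    intro i hi hD
    have hn2 : 2 ≤ 2 * K - 2 * i := by omega
    by_cases h3 : 3 ∣ 2 * K - 2 * i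
    · -- level `6s`: trigonal injectivity for `ψ'ᵢ`
      obtain ⟨s, hs⟩ : ∃ s, 2 * K - 2 * i = 6 * s := by
        obtain ⟨m, hm⟩ := h3
        refine ⟨m / 2, ?_⟩
        omega
      have hs1 : 1 ≤ s := by omega
      have hPm : bind₁ (linSubst Pm) (ψ' i) = (1 / 2 : ℝ) • ψ i := by
        refine MvPolynomial.funext fun x => ?_
        rw [eval_bind₁_linSubst, smul_eval]
        have h1 : eval (Pm.mulVec x) (ψ i) = eval x (ψ i) := by
          have := congrArg (eval x) (bind₁_Pm_eq_self (ψ i) hD)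
          rwa [eval_bind₁_linSubst] at this
        have h2 : eval (Pm.mulVec x) (ψ i) = 2 * eval (Pm.mulVec x) (ψ' i) := by
          show eval (Pm.mulVec x) (ψ' i + g (ψ' i)) = _
          rw [map_add, hg, eval_bind₁_linSubst, Rf_mulVec_Pm_mulVec]
          ring
        rw [← h1, h2]
        ring
      have hψ'0 : ψ' i = 0 := by
        refine hTI s hs1 (ψ' i) (hs ▸ hhom' i) (hharm' i) (hOψ' i (by omega)) ?_
        show lap (bind₁ (linSubst Pm) (ψ' i)) = 0
        rw [hPm, lap_smul, hharmψ i, smul_zero]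
      show ψ' i + g (ψ' i) = 0
      rw [hψ'0, map_zero, add_zero]
    · exact h2D (2 * K - 2 * i) (ψ i) (by omega) h3 (hhomψ i) (hharmψ i) hD (hpermψ i (by omega))
  -- induction upward from degree `2`
  have hbase : ψ (K - 1) = 0 := by
    have h2 : (ψ' (K - 1)).IsHomogeneous 2 := by
      have := hhom' (K - 1)
      rwa [show 2 * K - 2 * (K - 1) = 2 by omega] at this
    have hψ'0 : ψ' (K - 1) = 0 := harm_two_eq_zero _ h2 (hharm' _) (hOψ' _ (by omega))
    show ψ' (K - 1) + g (ψ' (K - 1)) = 0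
    rw [hψ'0, map_zero, add_zero]
  have hind : ∀ t, t ≤ K - 1 → ψ (K - 1 - t) = 0 := by
    intro t
    induction t with
    | zero => intro _; simpa using hbase
    | succ t ih =>
      intro ht
      have h1 : ψ (K - 1 - t) = 0 := ih (by omega)
      have h2 := hstep (K - 1 - (t + 1)) (by omega) (by rwa [show K - 1 - (t + 1) + 1 = K - 1 - t by omega])
      exact hvanish _ (by omega) h2
  have hlow : ∀ j ≤ K - 1, ψ j = 0 := fun j hj => by
    have := hind (K - 1 - j) (by omega)
    rwa [show K - 1 - (K - 1 - j) = j by omega] at this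
  -- the last rung: `s ψ_K = 0`
  have htop : ψ K = 0 := by
    have h := hQzero (K - 1) le_rfl
    have hKm : K - 1 + 1 = K := by omega
    simp only [hQ, hKm, hlow (K - 1) le_rfl, map_zero, Finset.sum_const_zero, smul_zero, add_zero] at h
    have hc : c₁ K ≠ 0 := by
      simp only [hc₁]
      have : (0 : ℝ) < 2 * (K : ℝ) * (2 * K + 2 * ((2 * K - 2 * K : ℕ) : ℝ) + 2) := by
        have hK' : (0 : ℝ) < K := by exact_mod_cast hK
        positivity
      exact this.ne'
    have hη : η' K = 0 := (smul_eq_zero.mp h).resolve_left hc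
    simp only [hη', hDψK, mul_zero, smul_zero, sub_zero] at hη
    exact (mul_eq_zero.mp hη).resolve_left sum_X_ne_zero
  -- conclude
  rw [hexpψ]
  refine Finset.sum_eq_zero fun j hj => ?_
  rcases Nat.lt_or_ge j K with hlt | hge
  · rw [hlow j (by omega), mul_zero]
  · obtain rfl : j = K := by have := Finset.mem_range.mp hj; omega
    rw [htop, mul_zero]

/-- **THE 3D THEOREM.**  Under the hypotheses of `sym_slice_eq_zero`, `h₀ = 0`: `h₀` is `σ`-odd and `O_h`-invariant, hence odd under the
reflections in two diagonal planes, hence zero by ✓`eq_zero_of_odd_under_two_diagonal_reflections`. -/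
theorem slice_eq_zero (K : ℕ) (hK : 1 ≤ K) (h₀ : P3) (hh : h₀.IsHomogeneous (2 * K)) (hO : OhInvariant h₀)
    (hPDE : (∑ i, X i) * lap (h₀ + bind₁ (linSubst Rf) h₀) + ∑ i, pderiv i (h₀ + bind₁ (linSubst Rf) h₀) = 0)
    (hTI : ∀ s : ℕ, 1 ≤ s → TrigonalInjectivityQ s)
    (h2D : ∀ (n : ℕ) (Y : P3), 1 ≤ n → ¬ 3 ∣ n → Y.IsHomogeneous n → lap Y = 0 → ∑ i, pderiv i Y = 0 →
      (∀ σ : Equiv.Perm (Fin 3), rename σ Y = Y) → Y = 0) :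
    h₀ = 0 := by
  have hodd : bind₁ (linSubst Rf) h₀ = -h₀ :=
    eq_neg_of_add_eq_zero_right (sym_slice_eq_zero K hK h₀ hh hO hPDE hTI h2D)
  have h₁ : ∀ x, eval (σ₁ x) h₀ = -eval x h₀ := by
    intro x
    have h := congrArg (eval x) hodd
    rwa [eval_bind₁_linSubst, map_neg, Rf_mulVec_eq_σ₁] at h
  have hF : ∀ y, eval ((flipMat 2).mulVec y) h₀ = eval y h₀ := by
    intro y
    have h := congrArg (eval y) (hO.2 2)
    rwa [eval_bind₁_linSubst] at h
  refine eq_zero_of_odd_under_two_diagonal_reflections h₀ h₁ fun x => ?_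
  rw [σ₂_eq_conj, hF, h₁, hF]

end Summit.QuantumFields.YangMills.Theorems.F4SubCurvatureDoorTorus

end
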